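import Literature.Probability.LatticeModels.LatticeInterface
import HarnessLib

/-!
# Polylines of lists with a common prefix agree up to the prefix time

Topic `Literature/Probability/LatticeModels` (family `crit-ising`); theorems only. The tree's
polyline `polyline (a :: l) = (polylineFrom a l).2` (`LatticeInterface.lean`) is built by
iterated `Path.trans` ending with a constant `Path.refl` tail, so its time parametrisation is
dyadic: with `l = m ++ r` the vertex `(a :: m).getLast`, i.e. the `m.length`-th vertex after
`a`, is reached at the **prefix time** `1 - 2^{-m.length}`, independently of the continuation
`r` (also for `r = []`). Consequently the
polylines of two vertex lists with a common prefix `a :: m` COINCIDE AS PARAMETRISED CURVES on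
the initial parameter interval `[0, 1 - 2^{-m.length}]` (`polylineFrom_append_apply_eq`,
`polyline_cons_append_eqOn`, `polyline_eqOn_of_take_eq`), take the value `(a :: m).getLast` at
its right end (`polylineFrom_append_apply_prefixTime`), and map it onto the trace of the prefix
polyline (`polylineFrom_append_image_Iic`, `polyline_cons_append_image_Iic`).

This is the lattice-side input of the locality of the Loewner transform
(`RandomPlanarGeometry/LoewnerTransformLocality.lean`, `IsLoewnerDescribed.eqOn_of_eqOn`:
representatives agreeing on `[0, s₀]` have the same driving function up to the capacity time of
the common piece): two configurations whose exploration interfaces share their first `n` steps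
(the atoms of the exploration filtration, `DiscreteDobrushin.explorationCylinder` of
`FKExplorationDomainMarkov.lean`) have interface polylines agreeing on `[0, 1 - 2^{-n}]`, which
is how "`ℱ_n` is the `σ`-algebra generated by `γ[0, n]`" and "`τ_t`, the first `n` at which
`φ(γ_δ[0, n])` has capacity `≥ t`, is a stopping time" are realised for curves modulo
reparametrisation (Duminil-Copin–Smirnov, Clay Math. Proc. 15 (2012), Lemma 6.6 and proof of
Prop. 6.7, p. 29 of arXiv:1109.1549).

## References

* F. Camia, C. M. Newman, Probab. Theory Related Fields 139 (2007), §2 (lattice paths as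
  polygonal curves). [CamiaNewman2007]
* H. Duminil-Copin, S. Smirnov, *Conformal invariance of lattice models*, Clay Math. Proc. 15
  (2012), Lemma 6.6 and proof of Prop. 6.7. [DuminilCopinSmirnov2012Clay]
-/

noncomputable section

open Set
open scoped unitInterval

namespace Literature.Probability.LatticeModels

section PolylinePrefix

variable {E : Type*} [AddCommGroup E] [Module ℝ E] [TopologicalSpace E] [ContinuousAdd E]
  [ContinuousSMul ℝ E]

/-- The prefix time `1 - 2^{-n}` lies in `[0, 1]`. [folklore] -/
theorem one_sub_half_pow_mem_unitInterval (n : ℕ) : (1 : ℝ) - (1 / 2) ^ n ∈ I := by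
  constructor
  · have : (1 / 2 : ℝ) ^ n ≤ 1 := pow_le_one₀ (by norm_num) (by norm_num)
    linarith
  · have : (0 : ℝ) ≤ (1 / 2) ^ n := by positivity
    linarith

/-- **Initial segment of a `Path.trans`**: for `T ≥ 1/2`, the image of `[0, T]` under
`γ.trans γ'` is the whole range of `γ` together with the image of `[0, 2T - 1]` under `γ'`.
[folklore] -/
theorem _root_.Path.image_Iic_trans_of_half_le {X : Type*} [TopologicalSpace X] {x y z : X}
    (γ : Path x y) (γ' : Path y z) {T : I} (hT : (1 / 2 : ℝ) ≤ T) {S : I}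
    (hS : (S : ℝ) = 2 * T - 1) :
    (γ.trans γ') '' Iic T = range γ ∪ γ' '' Iic S := by
  -- the first path is traversed during `[0, 1/2] ⊆ [0, T]`
  have hγ : range γ ⊆ (γ.trans γ') '' Iic T := by
    rintro _ ⟨u, rfl⟩
    have hu2 : (u : ℝ) / 2 ∈ I := ⟨by linarith [u.2.1], by linarith [u.2.2]⟩
    refine ⟨⟨u / 2, hu2⟩, ?_, ?_⟩
    · show (⟨(u : ℝ) / 2, hu2⟩ : I) ≤ T
      rw [← Subtype.coe_le_coe]
      change (u : ℝ) / 2 ≤ T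
      linarith [u.2.2]
    · rw [Path.trans_apply, dif_pos (show ((u : ℝ) / 2) ≤ 1 / 2 by linarith [u.2.2])]
      congr 1
      apply Subtype.ext
      change 2 * ((u : ℝ) / 2) = u
      ring
  apply Subset.antisymm
  · rintro _ ⟨t, ht, rfl⟩
    have ht' : (t : ℝ) ≤ T := Subtype.coe_le_coe.2 ht
    rw [Path.trans_apply]
    split_ifs with h
    · exact Or.inl ⟨_, rfl⟩
    · refine Or.inr ⟨⟨2 * t - 1, unitInterval.two_mul_sub_one_mem_iff.2 ⟨(not_le.1 h).le, t.2.2⟩⟩,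
        ?_, rfl⟩
      show (⟨2 * (t : ℝ) - 1, _⟩ : I) ≤ S
      rw [← Subtype.coe_le_coe, hS]
      change 2 * (t : ℝ) - 1 ≤ 2 * T - 1
      linarith
  · refine union_subset hγ ?_
    rintro _ ⟨v, hv, rfl⟩
    rcases eq_or_ne v 0 with rfl | hv0
    · -- `γ' 0 = y = γ 1`
      have h01 : γ' 0 = γ 1 := by rw [Path.source, Path.target]
      rw [h01]
      exact hγ ⟨1, rfl⟩
    · -- `γ' v = (γ.trans γ') ((v + 1) / 2)` for `v > 0`
      have hv' : (v : ℝ) ≤ S := Subtype.coe_le_coe.2 hv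
      have hvpos : (0 : ℝ) < v := lt_of_le_of_ne v.2.1 fun h ↦ hv0 (Subtype.ext h.symm)
      have hv2 : ((v : ℝ) + 1) / 2 ∈ I := ⟨by linarith [v.2.1], by linarith [v.2.2]⟩
      refine ⟨⟨(v + 1) / 2, hv2⟩, ?_, ?_⟩
      · show (⟨((v : ℝ) + 1) / 2, hv2⟩ : I) ≤ T
        rw [← Subtype.coe_le_coe]
        change ((v : ℝ) + 1) / 2 ≤ T
        linarith
      · rw [Path.trans_apply,
          dif_neg (show ¬ (((v : ℝ) + 1) / 2 ≤ 1 / 2) by intro h; linarith)]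
        congr 1
        apply Subtype.ext
        change 2 * (((v : ℝ) + 1) / 2) - 1 = v
        ring

/-- **Polylines with a common prefix agree up to the prefix time.** For any two continuations
`r₁, r₂` (possibly empty: a polyline ends with a constant tail) of a common vertex list
`a :: m`, the paths `polylineFrom a (m ++ r₁)` and `polylineFrom a (m ++ r₂)` coincide at every
parameter `t ≤ 1 - 2^{-m.length}` (dyadic parametrisation of iterated `Path.trans`).
[cite: CamiaNewman2007, §2] -/
theorem polylineFrom_append_apply_eq (a : E) (m r₁ r₂ : List E)
    {t : I} (ht : (t : ℝ) ≤ 1 - (1 / 2) ^ m.length) :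
    (polylineFrom a (m ++ r₁)).2 t = (polylineFrom a (m ++ r₂)).2 t := by
  induction m generalizing a t with
  | nil =>
    have ht0 : t = 0 := Subtype.ext (le_antisymm (by simpa using ht) t.2.1)
    subst ht0
    rw [Path.source, Path.source]
  | cons b m ih =>
    show ((Path.segment a b).trans (polylineFrom b (m ++ r₁)).2) t =
      ((Path.segment a b).trans (polylineFrom b (m ++ r₂)).2) t
    rw [Path.trans_apply, Path.trans_apply]
    split_ifs with h
    · rfl
    · refine ih b ?_
      change 2 * (t : ℝ) - 1 ≤ 1 - (1 / 2) ^ m.length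
      rw [List.length_cons, pow_succ] at ht
      linarith

/-- `polyline` form of `polylineFrom_append_apply_eq`: the polylines of `a :: (m ++ r₁)` and
`a :: (m ++ r₂)` agree on the parameter interval `[0, 1 - 2^{-m.length}]`.
[cite: CamiaNewman2007, §2] -/
theorem polyline_cons_append_eqOn (a : E) (m r₁ r₂ : List E) :
    EqOn (polyline (a :: (m ++ r₁))) (polyline (a :: (m ++ r₂)))
      (Iic ⟨1 - (1 / 2) ^ m.length, one_sub_half_pow_mem_unitInterval m.length⟩) := by
  intro t ht
  exact polylineFrom_append_apply_eq a m r₁ r₂ (show (t : ℝ) ≤ 1 - (1 / 2) ^ m.length from ht)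

/-- **Lists with the same first `n + 1` vertices have polylines agreeing on
`[0, 1 - 2^{-n}]`** (the lists having at least `n + 1` vertices). [cite: CamiaNewman2007, §2] -/
theorem polyline_eqOn_of_take_eq {l₁ l₂ : List E} {n : ℕ} (h : l₁.take (n + 1) = l₂.take (n + 1))
    (h₁ : n + 1 ≤ l₁.length) :
    EqOn (polyline l₁) (polyline l₂)
      (Iic ⟨1 - (1 / 2) ^ n, one_sub_half_pow_mem_unitInterval n⟩) := by
  -- decompose `lᵢ = p ++ rᵢ` with `p = a :: m`, `m.length = n`
  set p := l₁.take (n + 1) with hp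
  have hl₁ : l₁ = p ++ l₁.drop (n + 1) := (List.take_append_drop (n + 1) l₁).symm
  have hl₂ : l₂ = p ++ l₂.drop (n + 1) := by
    rw [h]
    exact (List.take_append_drop (n + 1) l₂).symm
  have hplen : p.length = n + 1 := by
    rw [hp, List.length_take]
    omega
  obtain ⟨a, m, hpm⟩ : ∃ a m, p = a :: m := by
    cases hq : p with
    | nil => rw [hq] at hplen; simp at hplen
    | cons a m => exact ⟨a, m, rfl⟩
  have hm : m.length = n := by
    rw [hpm, List.length_cons] at hplen
    omega
  rw [hl₁, hl₂, hpm, List.cons_append, List.cons_append]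
  have := polyline_cons_append_eqOn a m (l₁.drop (n + 1)) (l₂.drop (n + 1))
  rwa [hm] at this

/-- **The prefix time is the time of the last prefix vertex**: `polylineFrom a (m ++ r)` takes
the value `(a :: m).getLast` at the parameter `1 - 2^{-m.length}` (for every continuation `r`,
also `r = []`). [cite: CamiaNewman2007, §2] -/
theorem polylineFrom_append_apply_prefixTime (a : E) (m r : List E) :
    (polylineFrom a (m ++ r)).2 ⟨1 - (1 / 2) ^ m.length, one_sub_half_pow_mem_unitInterval _⟩ =
      (a :: m).getLast (List.cons_ne_nil a m) := by
  induction m generalizing a with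
  | nil =>
    have h0 : (⟨1 - (1 / 2) ^ ([] : List E).length, one_sub_half_pow_mem_unitInterval _⟩ : I) = 0 :=
      Subtype.ext (by simp)
    rw [h0, Path.source]
    simp
  | cons b m ih =>
    show ((Path.segment a b).trans (polylineFrom b (m ++ r)).2)
        ⟨1 - (1 / 2) ^ (m.length + 1), one_sub_half_pow_mem_unitInterval _⟩ =
      (a :: b :: m).getLast (List.cons_ne_nil a (b :: m))
    rw [Path.trans_apply, List.getLast_cons (List.cons_ne_nil b m)]
    split_ifs with h
    · -- `1 - 2^{-(|m|+1)} ≤ 1/2` forces `m = []`, and then the value is `b`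
      change (1 : ℝ) - (1 / 2) ^ (m.length + 1) ≤ 1 / 2 at h
      cases m with
      | nil =>
        simp only [List.getLast_singleton]
        convert (Path.segment a b).target using 2
        apply Subtype.ext
        change 2 * ((1 : ℝ) - (1 / 2) ^ (([] : List E).length + 1)) = 1
        norm_num
      | cons c m' =>
        exfalso
        have h1 : (1 / 2 : ℝ) ^ (m'.length + 1 + 1) ≤ 1 / 4 := by
          rw [pow_succ, pow_succ]
          have : (1 / 2 : ℝ) ^ m'.length ≤ 1 := pow_le_one₀ (by norm_num) (by norm_num)
          nlinarith
        rw [List.length_cons] at h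
        linarith
    · rw [← ih b]
      congr 1
      apply Subtype.ext
      change 2 * ((1 : ℝ) - (1 / 2) ^ (m.length + 1)) - 1 = 1 - (1 / 2) ^ m.length
      ring

/-- `polyline` form: the polyline of `a :: (m ++ r)` is at the vertex `(a :: m).getLast` at the
prefix time `1 - 2^{-m.length}`. [cite: CamiaNewman2007, §2] -/
theorem polyline_cons_append_apply_prefixTime (a : E) (m r : List E) :
    polyline (a :: (m ++ r)) ⟨1 - (1 / 2) ^ m.length, one_sub_half_pow_mem_unitInterval _⟩ =
      (a :: m).getLast (List.cons_ne_nil a m) :=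
  polylineFrom_append_apply_prefixTime a m r

/-- **The initial piece up to the prefix time is the trace of the prefix polyline**: the image
of `[0, 1 - 2^{-m.length}]` under `polylineFrom a (m ++ r)` is the range of `polylineFrom a m`
(the union of the closed segments of the prefix `a :: m`), for every continuation `r`.
[cite: CamiaNewman2007, §2] -/
theorem polylineFrom_append_image_Iic (a : E) (m r : List E) :
    (polylineFrom a (m ++ r)).2 '' Iic ⟨1 - (1 / 2) ^ m.length, one_sub_half_pow_mem_unitInterval _⟩ =
      range (polylineFrom a m).2 := by
  induction m generalizing a with
  | nil =>
    have h0 : (⟨1 - (1 / 2) ^ ([] : List E).length, one_sub_half_pow_mem_unitInterval _⟩ : I) = 0 :=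
      Subtype.ext (by simp)
    rw [h0, polylineFrom_nil]
    change (polylineFrom a r).2 '' Iic 0 = range (Path.refl a)
    rw [Path.refl_range]
    apply Subset.antisymm
    · rintro _ ⟨t, ht, rfl⟩
      have ht0 : t = 0 := le_antisymm ht unitInterval.nonneg'
      rw [ht0, Path.source]
      exact mem_singleton a
    · rintro _ ⟨⟩
      exact ⟨0, self_mem_Iic, Path.source _⟩
  | cons b m ih =>
    show ((Path.segment a b).trans (polylineFrom b (m ++ r)).2) ''
        Iic ⟨1 - (1 / 2) ^ (m.length + 1), one_sub_half_pow_mem_unitInterval _⟩ =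
      range ((Path.segment a b).trans (polylineFrom b m).2)
    rw [Path.trans_range, Path.image_Iic_trans_of_half_le (Path.segment a b)
      (polylineFrom b (m ++ r)).2 (S := ⟨1 - (1 / 2) ^ m.length, one_sub_half_pow_mem_unitInterval _⟩)
      ?_ ?_, ih b]
    · change (1 / 2 : ℝ) ≤ 1 - (1 / 2) ^ (m.length + 1)
      rw [pow_succ]
      have : (1 / 2 : ℝ) ^ m.length ≤ 1 := pow_le_one₀ (by norm_num) (by norm_num)
      linarith
    · change (1 : ℝ) - (1 / 2) ^ m.length = 2 * (1 - (1 / 2) ^ (m.length + 1)) - 1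
      ring

/-- `polyline` form: the image of `[0, 1 - 2^{-m.length}]` under the polyline of
`a :: (m ++ r)` is the range of the prefix polyline `polyline (a :: m)`. [cite: CamiaNewman2007, §2] -/
theorem polyline_cons_append_image_Iic (a : E) (m r : List E) :
    polyline (a :: (m ++ r)) '' Iic ⟨1 - (1 / 2) ^ m.length, one_sub_half_pow_mem_unitInterval _⟩ =
      range (polyline (a :: m)) :=
  polylineFrom_append_image_Iic a m r

/-- `List.take` form: if `n + 1 ≤ l.length` then the image of `[0, 1 - 2^{-n}]` under
`polyline l` is the range of the polyline of the first `n + 1` vertices. [cite: CamiaNewman2007, §2] -/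
theorem polyline_image_Iic_eq_range_take {l : List E} {n : ℕ} (hn : n + 1 ≤ l.length) :
    polyline l '' Iic ⟨1 - (1 / 2) ^ n, one_sub_half_pow_mem_unitInterval n⟩ =
      range (polyline (l.take (n + 1))) := by
  set p := l.take (n + 1) with hp
  have hl : l = p ++ l.drop (n + 1) := (List.take_append_drop (n + 1) l).symm
  have hplen : p.length = n + 1 := by
    rw [hp, List.length_take]
    omega
  obtain ⟨a, m, hpm⟩ : ∃ a m, p = a :: m := by
    cases hq : p with
    | nil => rw [hq] at hplen; simp at hplen
    | cons a m => exact ⟨a, m, rfl⟩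
  have hm : m.length = n := by
    rw [hpm, List.length_cons] at hplen
    omega
  rw [hl, hpm, List.cons_append]
  have := polyline_cons_append_image_Iic a m (l.drop (n + 1))
  rwa [hm] at this

end PolylinePrefix

end Literature.Probability.LatticeModels
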